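import Summits.CriticalPhenomena.PercolationContinuityZ3.Theorems.Transplant.FKDoubleFanTwoSidedConeSCrossA
import HarnessLib

/-!
# Double fans `K₂ ∨ P_{m+1}`: the EXACT criterion for (CL-a)_S ∧ (CL-b)_S — cross-positivity of `T_a` and `T_b` on the closure of the
# normalised two-sided images (tangency at the boundary generators of `tsConeS`), part B

Helper file (`--supports stmt-CriticalPhenomena-4575`), FK sub-lane `prim-bschramm-fk-3` (gen 41); builds on p205010 (kernel theorem, internal
audit signed; external expert review pending).  No named facts, no sorries; standard axioms.  Memo `bschramm/prim-bschramm-fk-3/FAR-CROSS-XVI.md` §5.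

With the machinery of part A (`…TwoSidedConeSCrossA`): **`hypBS_of_crossPos2`** / **`hypAS_of_crossPos2`** — a functional `e₀` uniformly positive on
both image families plus cross-positivity of `T_b` (resp. `T_a`) on `atomClosure2 q` (`⟪T β, ρ⟫ ≥ 0` whenever `β ∈ atomClosure2 q`, `ρ ∈ TSDualS q`,
`⟪β, ρ⟫ = 0`) give `HypBS q` (resp. `HypAS q`); both criteria are EXACT (**`crossPosB_of_hypBS`**, **`crossPosA_of_hypAS`**); and
**`negCorr_spokes_cross_far_of_crossPos2`**: the two cross-positivity conditions (+ `e₀`) ⟹ the far cross-apex theorem for every middle (`0 < q ≤ 1`).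
WHY THIS IS THE RIGHT TARGET (memo §5): cross-positivity is LOCAL — it only has content at generators on the boundary of the cone, and there a
certificate may use a free multiple of the generator and every derivative direction along curves of generators (`T β ∈ cone(generators) + ℝβ +
span(tangential derivatives)`); generators whose own letter-orbit stays among the generators (`b`-images for `T_b`; `a`-images for `T_a`) are
automatically cross-positive.  So (CL-b)_S reduces to local certificates at the BOUNDARY `a`-generators (and `a`-type tangent atoms), (CL-a)_S to
the boundary `b`-generators.  Numerically (memo §0(B)/§4, guarded runs j284330–48, j284408–16) the tested two-sided targets are explicit members
of the cone (NNLS residual `≤ 10⁻¹²`, mass `≈ 1`) at `q ∈ {0.1, 0.25, 0.4, 0.7}`; `q = 0.05` is numerically undecided (degenerate dictionaries).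
[folklore]
-/

noncomputable section

open Filter Topology

namespace Summit.CriticalPhenomena.PercolationContinuityZ3.Theorems

namespace FK

namespace ThreeApex

/-! ### The exact criteria for (CL-b)_S and (CL-a)_S -/

/-- **`HypBS` from cross-positivity of `T_b` on the two-sided generators** (`0 < q ≤ 1`): a functional `e₀` uniformly positive on both image
families (`c·‖img‖ ≤ ⟪img, e₀⟫`, `c > 0`) and `⟪T_b β, ρ⟫ ≥ 0` for every `β ∈ atomClosure2 q`, `ρ ∈ TSDualS q` with `⟪β, ρ⟫ = 0`, give `HypBS q`. [folklore] -/
theorem hypBS_of_crossPos2 {q : ℝ} (hq0 : 0 < q) (hq1 : q ≤ 1) (e₀ : Biv) {c : ℝ} (hc : 0 < c)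
    (hposA : ∀ F w : V5, InS q F → InS q w → c * ‖Biv.toFun (imgA q F w)‖ ≤ pairH q (imgA q F w) e₀)
    (hposB : ∀ G w : V5, InS q G → InS q w → c * ‖Biv.toFun (imgB q G w)‖ ≤ pairH q (imgB q G w) e₀)
    (hcross : ∀ v ∈ atomClosure2 q, ∀ ρ : Biv, TSDualS q ρ → pairH q (Biv.ofFun v) ρ = 0 → 0 ≤ pairH q (opTb (Biv.ofFun v)) ρ) :
    HypBS q := by
  set P := atomClosure2 q
  set α : (Fin 10 → ℝ) → Biv := fun v => Biv.ofFun v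
  have hPc : IsCompact P := isCompact_atomClosure2 q
  have hPn : P.Nonempty := atomClosure2_nonempty hq0 hq1
  have hec : ∀ v ∈ P, c ≤ pairH q (α v) e₀ := atomClosure2_le_of_atoms hposA hposB
  have he : ∀ v ∈ P, 0 < pairH q (α v) e₀ := fun v hv => lt_of_lt_of_le hc (hec v hv)
  have hcont : ∀ ρ : Biv, ContinuousOn (fun v => pairH q (α v) ρ) P := fun ρ => (continuous_pairH_ofFun q ρ).continuousOn
  have hcontq : ∀ ρ : Biv, ContinuousOn (fun v => pairH q (α v) ρ / pairH q (α v) e₀) P :=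
    fun ρ => (hcont ρ).div (hcont e₀) fun v hv => (he v hv).ne'
  obtain ⟨vM, hvM, hmax⟩ := hPc.exists_isMaxOn hPn (hcontq (opTb e₀))
  set M : ℝ := max (pairH q (α vM) (opTb e₀) / pairH q (α vM) e₀) 1 with hMdef
  have hM0 : 0 < M := lt_of_lt_of_le zero_lt_one (le_max_right _ _)
  have hM : ∀ v ∈ P, pairH q (α v) (opTb e₀) ≤ M * pairH q (α v) e₀ :=
    fun v hv => (div_le_iff₀ (he v hv)).1 (le_trans (hmax hv) (le_max_left _ _))
  have hmin : ∀ ρ : Biv, (∃ x ∈ P, pairH q (α x) ρ < 0) →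
      ∃ x₀ ∈ P, ∀ x ∈ P, pairH q (α x₀) ρ * pairH q (α x) e₀ ≤ pairH q (α x) ρ * pairH q (α x₀) e₀ := by
    intro ρ _
    obtain ⟨x₀, hx₀, hmin⟩ := hPc.exists_isMinOn hPn (hcontq ρ)
    exact ⟨x₀, hx₀, fun x hx => (div_le_div_iff₀ (he x₀ hx₀) (he x hx)).1 (hmin hx)⟩
  have hcross' : ∀ x ∈ P, ∀ ρ : Biv, PDual q P α ρ → pairH q (α x) ρ = 0 → 0 ≤ pairH q (opTb (α x)) ρ :=
    fun x hx ρ hρ h0 => hcross x hx ρ ((tsDualS_iff_atomClosure2 q ρ).2 hρ) h0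
  have hdual : ∀ ρ : Biv, TSDualS q ρ → ∀ y : ℝ, 0 ≤ y → y < 1 → TSDualS q (opBC y ρ) := by
    intro ρ hρ y hy0 hy1
    exact (tsDualS_iff_atomClosure2 q _).2
      (pdual_opBC he hM hmin hcross' hM0 hy0 hy1 ((tsDualS_iff_atomClosure2 q ρ).1 hρ))
  have hlt : ∀ F w : V5, InS q F → InS q w → ∀ y : ℝ, 0 ≤ y → y < 1 → opBC y (imgA q F w) ∈ tsConeS q := by
    intro F w hF hw y hy0 hy1 ρ hρ
    rw [pairH_opBC]
    exact (hdual ρ hρ y hy0 hy1).1 F w hF hw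
  intro F w y hF hw hy0 hy1
  rcases lt_or_eq_of_le hy1 with h | rfl
  · exact hlt F w hF hw y hy0 h
  · exact opBC_one_mem_tsConeS_of_lt fun y' hy'0 hy'1 => hlt F w hF hw y' hy'0 hy'1

/-- **`HypAS` from cross-positivity of `T_a` on the two-sided generators** (`0 < q ≤ 1`). [folklore] -/
theorem hypAS_of_crossPos2 {q : ℝ} (hq0 : 0 < q) (hq1 : q ≤ 1) (e₀ : Biv) {c : ℝ} (hc : 0 < c)
    (hposA : ∀ F w : V5, InS q F → InS q w → c * ‖Biv.toFun (imgA q F w)‖ ≤ pairH q (imgA q F w) e₀)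
    (hposB : ∀ G w : V5, InS q G → InS q w → c * ‖Biv.toFun (imgB q G w)‖ ≤ pairH q (imgB q G w) e₀)
    (hcross : ∀ v ∈ atomClosure2 q, ∀ ρ : Biv, TSDualS q ρ → pairH q (Biv.ofFun v) ρ = 0 → 0 ≤ pairH q (opTa (Biv.ofFun v)) ρ) :
    HypAS q := by
  set P := atomClosure2 q
  set α : (Fin 10 → ℝ) → Biv := fun v => Biv.ofFun v
  have hPc : IsCompact P := isCompact_atomClosure2 q
  have hPn : P.Nonempty := atomClosure2_nonempty hq0 hq1
  have hec : ∀ v ∈ P, c ≤ pairH q (α v) e₀ := atomClosure2_le_of_atoms hposA hposB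
  have he : ∀ v ∈ P, 0 < pairH q (α v) e₀ := fun v hv => lt_of_lt_of_le hc (hec v hv)
  have hcont : ∀ ρ : Biv, ContinuousOn (fun v => pairH q (α v) ρ) P := fun ρ => (continuous_pairH_ofFun q ρ).continuousOn
  have hcontq : ∀ ρ : Biv, ContinuousOn (fun v => pairH q (α v) ρ / pairH q (α v) e₀) P :=
    fun ρ => (hcont ρ).div (hcont e₀) fun v hv => (he v hv).ne'
  obtain ⟨vM, hvM, hmax⟩ := hPc.exists_isMaxOn hPn (hcontq (opTa e₀))
  set M : ℝ := max (pairH q (α vM) (opTa e₀) / pairH q (α vM) e₀) 1 with hMdef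
  have hM0 : 0 < M := lt_of_lt_of_le zero_lt_one (le_max_right _ _)
  have hM : ∀ v ∈ P, pairH q (α v) (opTa e₀) ≤ M * pairH q (α v) e₀ :=
    fun v hv => (div_le_iff₀ (he v hv)).1 (le_trans (hmax hv) (le_max_left _ _))
  have hmin : ∀ ρ : Biv, (∃ x ∈ P, pairH q (α x) ρ < 0) →
      ∃ x₀ ∈ P, ∀ x ∈ P, pairH q (α x₀) ρ * pairH q (α x) e₀ ≤ pairH q (α x) ρ * pairH q (α x₀) e₀ := by
    intro ρ _
    obtain ⟨x₀, hx₀, hmin⟩ := hPc.exists_isMinOn hPn (hcontq ρ)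
    exact ⟨x₀, hx₀, fun x hx => (div_le_div_iff₀ (he x₀ hx₀) (he x hx)).1 (hmin hx)⟩
  have hcross' : ∀ x ∈ P, ∀ ρ : Biv, PDual q P α ρ → pairH q (α x) ρ = 0 → 0 ≤ pairH q (opTa (α x)) ρ :=
    fun x hx ρ hρ h0 => hcross x hx ρ ((tsDualS_iff_atomClosure2 q ρ).2 hρ) h0
  have hdual : ∀ ρ : Biv, TSDualS q ρ → ∀ x : ℝ, 0 ≤ x → x < 1 → TSDualS q (opAC x ρ) := by
    intro ρ hρ x hx0 hx1
    exact (tsDualS_iff_atomClosure2 q _).2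
      (pdual_opAC he hM hmin hcross' hM0 hx0 hx1 ((tsDualS_iff_atomClosure2 q ρ).1 hρ))
  have hlt : ∀ G w : V5, InS q G → InS q w → ∀ x : ℝ, 0 ≤ x → x < 1 → opAC x (imgB q G w) ∈ tsConeS q := by
    intro G w hG hw x hx0 hx1 ρ hρ
    rw [pairH_opAC]
    exact (hdual ρ hρ x hx0 hx1).2 G w hG hw
  intro G w x hG hw hx0 hx1
  rcases lt_or_eq_of_le hx1 with h | rfl
  · exact hlt G w hG hw x hx0 h
  · exact opAC_one_mem_tsConeS_of_lt fun x' hx'0 hx'1 => hlt G w hG hw x' hx'0 hx'1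

/-- **The `T_b` criterion is exact**: `HypBS q` (`0 < q ≤ 1`) implies cross-positivity of `T_b` on `atomClosure2 q`. [folklore] -/
theorem crossPosB_of_hypBS {q : ℝ} (hq0 : 0 < q) (hq1 : q ≤ 1) (hB : HypBS q) :
    ∀ v ∈ atomClosure2 q, ∀ ρ : Biv, TSDualS q ρ → pairH q (Biv.ofFun v) ρ = 0 → 0 ≤ pairH q (opTb (Biv.ofFun v)) ρ := by
  intro v hv ρ hρ h0
  set β := Biv.ofFun v with hβ
  have hβK : β ∈ tsConeS q := ofFun_mem_tsConeS_of_mem_atomClosure2 hv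
  have hg : ∀ y : ℝ, 0 ≤ y → y ≤ 1 → 0 ≤ y * (1 - y) * pairH q (opTb β) ρ + y ^ 2 * pairH q (opWb β) ρ := by
    intro y hy0 hy1
    have := hβK _ (hρ.bc hq0 hq1 hB hy0 hy1)
    rwa [← pairH_opBC, pairH_opBC_poly, h0, mul_zero, zero_add] at this
  by_contra hT; rw [not_le] at hT
  set T := pairH q (opTb β) ρ with hTdef
  set W := pairH q (opWb β) ρ with hWdef
  by_cases hW : W ≤ 0
  · have := hg (1 / 2) (by norm_num) (by norm_num)
    nlinarith
  · rw [not_le] at hW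
    have hWT : 0 < W - T := by linarith
    set y : ℝ := -T / (2 * (W - T)) with hy
    have hy0 : 0 < y := by rw [hy]; exact div_pos (by linarith) (by linarith)
    have hy1 : y ≤ 1 / 2 := by rw [hy, div_le_iff₀ (by linarith)]; linarith
    have := hg y hy0.le (by linarith)
    have e : y * (1 - y) * T + y ^ 2 * W = y * (T + y * (W - T)) := by ring
    have e2 : y * (W - T) = -T / 2 := by rw [hy]; field_simp
    rw [e, e2] at this
    nlinarith

/-- **The `T_a` criterion is exact**: `HypAS q` (`0 < q ≤ 1`) implies cross-positivity of `T_a` on `atomClosure2 q`. [folklore] -/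
theorem crossPosA_of_hypAS {q : ℝ} (hq0 : 0 < q) (hq1 : q ≤ 1) (hA : HypAS q) :
    ∀ v ∈ atomClosure2 q, ∀ ρ : Biv, TSDualS q ρ → pairH q (Biv.ofFun v) ρ = 0 → 0 ≤ pairH q (opTa (Biv.ofFun v)) ρ := by
  intro v hv ρ hρ h0
  set β := Biv.ofFun v with hβ
  have hβK : β ∈ tsConeS q := ofFun_mem_tsConeS_of_mem_atomClosure2 hv
  have hg : ∀ x : ℝ, 0 ≤ x → x ≤ 1 → 0 ≤ x * (1 - x) * pairH q (opTa β) ρ + x ^ 2 * pairH q (opWa β) ρ := by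
    intro x hx0 hx1
    have := hβK _ (hρ.ac hq0 hq1 hA hx0 hx1)
    rwa [← pairH_opAC, pairH_opAC_poly, h0, mul_zero, zero_add] at this
  by_contra hT; rw [not_le] at hT
  set T := pairH q (opTa β) ρ with hTdef
  set W := pairH q (opWa β) ρ with hWdef
  by_cases hW : W ≤ 0
  · have := hg (1 / 2) (by norm_num) (by norm_num)
    nlinarith
  · rw [not_le] at hW
    have hWT : 0 < W - T := by linarith
    set x : ℝ := -T / (2 * (W - T)) with hx
    have hx0 : 0 < x := by rw [hx]; exact div_pos (by linarith) (by linarith)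
    have hx1 : x ≤ 1 / 2 := by rw [hx, div_le_iff₀ (by linarith)]; linarith
    have := hg x hx0.le (by linarith)
    have e : x * (1 - x) * T + x ^ 2 * W = x * (T + x * (W - T)) := by ring
    have e2 : x * (W - T) = -T / 2 := by rw [hx]; field_simp
    rw [e, e2] at this
    nlinarith

open MeasureTheory Literature.Probability.LatticeModels Literature.Probability.Percolation
open scoped Classical

variable {V : Type*} [Fintype V]

section Setting

variable {a b : V} {c : ℕ → V} {m : ℕ}
variable (hab : a ≠ b) (hinj : ∀ j k, j ≤ m → k ≤ m → c j = c k → j = k) (hca : ∀ j, j ≤ m → c j ≠ a) (hcb : ∀ j, j ≤ m → c j ≠ b)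
include hab hinj hca hcb

/-- **CROSS-POSITIVITY OF `T_a` AND `T_b` ON THE TWO-SIDED GENERATORS ⟹ THE FAR CROSS-APEX THEOREM FOR EVERY MIDDLE** (`0 < q ≤ 1`):
given a functional `e₀` uniformly positive on both image families and the two local tangency conditions at the generators of `tsConeS q`, every
cross-apex pair `(a c_j, b c_k)`, `j < k ≤ m`, of every weighted double fan is negatively correlated. [folklore] -/
theorem negCorr_spokes_cross_far_of_crossPos2 (hcard : Fintype.card V = m + 3) {q : ℝ} (hq0 : 0 < q) (hq1 : q ≤ 1)
    (w : Sym2 V → unitInterval) (hsupp : ∀ e, e ∉ dfPairs a b c m → w e = 0) (e₀ : Biv) {c₀ : ℝ} (hc : 0 < c₀)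
    (hposA : ∀ F u : V5, InS q F → InS q u → c₀ * ‖Biv.toFun (imgA q F u)‖ ≤ pairH q (imgA q F u) e₀)
    (hposB : ∀ G u : V5, InS q G → InS q u → c₀ * ‖Biv.toFun (imgB q G u)‖ ≤ pairH q (imgB q G u) e₀)
    (hcrossA : ∀ v ∈ atomClosure2 q, ∀ ρ : Biv, TSDualS q ρ → pairH q (Biv.ofFun v) ρ = 0 → 0 ≤ pairH q (opTa (Biv.ofFun v)) ρ)
    (hcrossB : ∀ v ∈ atomClosure2 q, ∀ ρ : Biv, TSDualS q ρ → pairH q (Biv.ofFun v) ρ = 0 → 0 ≤ pairH q (opTb (Biv.ofFun v)) ρ)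
    {j k : ℕ} (hjk : j < k) (hk : k ≤ m) :
    (rcMeasureW w q ∅).real ({ω : BondConfig V | s(a, c j) ∈ ω} ∩ {ω | s(b, c k) ∈ ω}) ≤
      (rcMeasureW w q ∅).real {ω : BondConfig V | s(a, c j) ∈ ω} * (rcMeasureW w q ∅).real {ω : BondConfig V | s(b, c k) ∈ ω} :=
  negCorr_spokes_cross_far_of_hypABS hab hinj hca hcb hcard hq0 hq1 w hsupp
    (hypAS_of_crossPos2 hq0 hq1 e₀ hc hposA hposB hcrossA) (hypBS_of_crossPos2 hq0 hq1 e₀ hc hposA hposB hcrossB) hjk hk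

end Setting

end ThreeApex

end FK

end Summit.CriticalPhenomena.PercolationContinuityZ3.Theorems
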